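import Literature.MathematicalPhysics.QuantumFieldTheory.Balaban1983to89.B6Block112GEV1
import Literature.MathematicalPhysics.QuantumFieldTheory.Balaban1983to89.B6Block112CompositesV1
import Literature.MathematicalPhysics.QuantumFieldTheory.Balaban1983to89.B6Prop25GDivDecayTwoScaleV1

/-!
# `Balaban1983to89.B6Prop25Eq112TwoScaleV1` — T. Bałaban, *Propagators and renormalization transformations for lattice gauge theories. II*,
# Commun. Math. Phys. **96** (1984) 223–250 [Balaban1984PropagatorsII], PROPOSITION 2.5 p. 246, THE MEMBER (1.112)
# `|(∇G∇*J)(x)| ≤ O(1)e^{−δ₂|y−y′|}(‖J‖_ε + |J|)` FOR THE GENUINE TWO-SCALE `G = Δ_a⁻¹` OF (2.90), `Λ′ ⊂ T^{(j+1)}` ARBITRARY, for `tsV1` at the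
# paper's scaling — file M3 of the (1.112)/(1.113) members (p38 gen 22), the assembly

statement-level skeleton of published theorems with citation tags; proofs where landed; nothing here is a claim about the Yang–Mills mass gap

PDF held: `paper:balaban1984-cmp96-propagators-rt-ii` (journal page = PDF page + 222), p. 246 [PDF 24]; `paper:balaban1984-cmp95-propagators-rt-i` ([4],
journal page = PDF page + 16), p. 36 [PDF 20].  PRINT.  p. 246 (Proposition 2.5, verbatim): *"The operator G_□ defined by (2.90) on the torus T_□
(or on the whole lattice ξZ^d) has the representation (2.129) and satisfies all the inequalities (1.110)–(1.114) of the Proposition 1.2 with a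
positive constant δ₂ instead of δ₀. This constant depends on d and L only."*  [4] (1.112) p. 36 (verbatim, as quoted in the tree's `B5.Prop12Printed`):
*"|(∇G∇*J)(x)| ≤ O(1)e^{−δ₀|y−y′|}(‖J‖_ε + |J|) (1.112) for 0 < ε < 1, x ∈ Δ̃(y), supp J ⊂ Δ̃(y′), with the constant O(1) depending on d and ε
(O(1) → ∞ if ε → 0)"*, (1.109): *"‖A‖_α = max_μ sup_{x,x′:|x−x′|≤1} |x−x′|^{−α}|A_μ(x) − A_μ(x′)|"*.

CITATION HEADER (lean-in-tree rule) — WHAT IS REPRODUCED.  Phase-2 file of the `lit-balaban` typed skeleton (HOME `run/shared/lean/pub/lit-balaban/`),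
seat **p38 gen 22** (B6 fold owner r03, referee ref-4; p22 g15 hand-off 2026-08-22T10:32Z), FILE M3 of the (1.112)/(1.113) members of p22's Prop. 2.5
two-level decay programme (files M1a `…B6Block112DictionaryV1`, M1b `…B6Block112GEV1`, M2 `…B6Block112CompositesV1`); SKELETON rows **B6.Prop2.5** /
**B6.Eq2.129–2.131** and [4] **B5.Prop1.2** (cells only; decls of record untouched).  WHAT THIS FILE DOES.  Differentiating (2.129) (p22's
`G_apply_V1`) on the left by `∇_μ = n(S_μ − I)` and composing on the right with `∇_λ* = n(S_λ⁻¹ − I)`, with `M = G̃_j + H_jC̃H_j*` and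
`G̃_j = (I − H_jQ_j)G^{(n^{d+1})}` (p22's `Gt_eq_comp_GE`): `∇_μG∇_λ*J = ∇_μK₁∇_λ*J + ∇_μG^{(n^{d+1})}∇_λ*J − (∇_μH_j)Q_jG^{(n^{d+1})}∇_λ*J +
(∇_μH_j)C̃(∇_λH_j)*J − (∇_μM)K₂∇_λ*J − (∇_μK₂*)M∇_λ*J + (∇_μK₂*)MK₂∇_λ*J` (`DGDadj_apply_eq`, pointwise); six summands are operators with uniform BLOCK
bounds (file M2: `blockBound_DK1Dadj_scaling`, `blockBound_DHjQGEDadj_scaling`, `blockBound_DHjCtDHjadj_scaling`; p22 files 5, 6, 9, 13, 14: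
`blockBound_DGt_scaling`, `blockBound_DHjCtHj_scaling`, `blockBound_K2Dadj_scaling`, `blockBound_DK2adj_scaling`, `blockBound_GtDadj_scaling`,
`blockBound_HjCtDHjadj_scaling`, `blockBound_Gt_scaling`, `blockBound_HjCtHj_scaling`, composed by file 2's `blockBound_comp`) and are evaluated on a
source supported over the unit sites within `r` of `y′` by file 2's `abs_apply_le_of_support`; the summand `∇_μG^{(n^{d+1})}∇_λ*J` is [4] (1.112) FOR
`G_k` BY NAME in the cube-sup form of file M1b (`cubeSup112_DGEDadj_scaling`: the only term carrying the Hölder norm of `J`).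
**`prop25_ineq112`**: there is `δ₂ > 0` depending on `d, L, a₀, a₁` only and for every `0 < ε < 1` a `C_ε ≥ 0` such that for every volume,
`j + 1 ≤ m + K`, `Λ′`, weights `a₀n^{d+1} ≤ w ≤ a₁n^{d+1}`, directions `λ, μ`, radius `r ≥ 0`, every fine bond field `J` supported on the fine
bonds over the unit sites within `r` of `y′` with `|J| ≤ X` and `|J(b) − J(b′)| ≤ X_ε·(|b₋ − b₋′|_∞/n)^ε` on same-direction pairs at `|b₋ − b₋′|_∞ ≤ n`
(`n = L^j`; the (1.109) Hölder quotient of `J`), and every fine bond `b₀` over the unit sites within `r` of `y`: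
`|(∇_μG∇_λ*J)(b₀)| ≤ C_ε·e^{(1+2δ₂)(r+3)}·e^{−δ₂|y − y′|_T}·(X_ε + X)`; v1.1 **`prop25_ineq112_upto`**: the same at EVERY rate `0 < δ ≤ δ₂` with
`C_ε` independent of `δ` (for the (1.113) assembly of file M6); v1.2 (p38 gen 23, PROOF-ONLY, statements byte-identical): every operator term is
elaborated once — the block-bound theorems are instantiated with `_` for the operator, the real arithmetic is hoisted into `reanchor_le` /
`assemble_seven_le` over opaque reals — so the file builds at the DEFAULT heartbeat budget (v1.1 needed `maxHeartbeats 2400000`; ops-buildfix-2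
T16); v1.2.1: the rate/constant bookkeeping (`δ₀/4 ≤ δ₀/2 ≤ δ₀`, nonnegativity of the composite constants) is done ONCE, before the volume
data are introduced, by explicit terms (no `set`, no `positivity`/`linarith` in the large context): `prop25_ineq112_upto` measures 71 289 heartbeats
on the farm (v1.2: 166 356; v1.1: > 800 000).  IMPORTS BY NAME, restating nothing.  THEOREMS ONLY (no `def`, no
`def … : Prop`); standard axioms.  HONEST SCOPE / DIVERGENCES. (1) One component: `∇_μ` on the left, one `∇_λ*` on the right (the printed `∇G∇*J`,
`∇*J = Σ_λ∇_λ*J_λ`, is recovered by summing over `λ` and maximising over `μ`; r03's census slot `e4TS`). (2) `x ∈ Δ̃(y)`, `supp J ⊂ Δ̃(y′)` are replaced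
by supports over the unit sites within `r` of `y`, `y′` (p22's radius-`r` packaging; growth `e^{(1+2δ₂)(r+3)}`, the `+3` from r02's unit-scale
partition in file M1b). (3) The rate `δ₂ = δ₂(d, L, a₀, a₁)` is `ε`-FREE (as printed); only `C_ε` depends on `ε` (through [4]'s `O(1)(ε)` for `G_k`).
(4) `‖J‖_ε` enters as the bound `X_ε` on the Hölder quotients at pairs `|b₋ − b₋′|_∞ ≤ n` (as (1.109)). (5) No new definition, no new hypothesis.
NOT summit progress.  Unit `lit-balaban-p38` (gen 22), 2026-08-22.
-/

noncomputable section

open scoped InnerProductSpace BigOperators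
open Finset

namespace Literature.MathematicalPhysics.QuantumFieldTheory.Balaban1983to89.B6Prop25Eq112TwoScaleV1

open LatticeFieldCalculus B5SectBStatements B5Eq117TorusCarriers B6SectADomainsV1 B6SectAOperatorsV1 B6SectAVectorModelV1 B6SectCOperators
  B6SectCTwoScaleV1 B6SectCTwoScaleV1Lattice B5Eq118OneStroke
open BalabanImbrieJaffe1984to88.BIJ85AxialPropagator411 (BondSpace)
open B4Sect5Torus (IsPseudoDist SumBound)
open B4TorusKernel.MultiPeriod (torusSupNorm torusSupNorm_nonneg)
open B4Sect5Proof (latticeConst latticeConst_nonneg)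
open B6LowerBound2153Torus (rep)
open B6Repr2129Operator (G_apply_V1)
open B6BlockDecayCalculus (blockBound_comp blockBound_add blockBound_mono abs_apply_le_of_support torusDist_isPseudoDist torusDist_sumBound)
open B6BlockDecayHjCovV1 (blockBound_HjCtHj_scaling)
open B6BlockDecayGtV1 (Gt_eq_comp_GE blockBound_Gt_scaling)
open B6BlockDecayGradCompositesV1 (blockBound_DK2adj_scaling blockBound_DHjCtHj_scaling blockBound_DGt_scaling)
open B6BlockDecayGDivFactorsV1 (blockBound_K2Dadj_scaling blockBound_HjCtDHjadj_scaling)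
open B6Prop25GDivDecayTwoScaleV1 (blockBound_GtDadj_scaling)
open B6Block112GEV1 (cubeSup112_DGEDadj_scaling)
open B6Block112CompositesV1 (blockBound_DK1Dadj_scaling blockBound_DHjQGEDadj_scaling blockBound_DHjCtDHjadj_scaling)

variable {d L m K : ℕ} {hd : 1 ≤ d + 1} {hL : Odd L ∧ 1 < L} {j : ℕ}

/-! ## §1  The pointwise identity: `∇_μG∇_λ*J` as seven summands -/

section Identity

variable (hc : ((L : ℝ) ^ j) ≠ 0) (hj : j + 1 ≤ (⟨d + 1, L, m, K, hd, hL⟩ : Params).m + (⟨d + 1, L, m, K, hd, hL⟩ : Params).K) (Λ' : Finset (Site (⟨d + 1, L, m, K, hd, hL⟩ : Params) (j + 1))) {w : CIdx j Λ' → ℝ} (hw : ∀ i, 0 < w i)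
  (hw' : (0 : ℝ) < 1 * ((L : ℝ) ^ j) ^ (d + 1))

include hw hw' in
/-- **`∇_μG∇_λ*J` AS SEVEN SUMMANDS** (pointwise, for `tsV1` at `c = L^j`): with `u = ∇_λ*J`, `M = G̃_j + H_jC̃H_j*`,
`∇_μGu = ∇_μK₁u + ∇_μG^{(n^{d+1})}u − ∇_μH_jQ_jG^{(n^{d+1})}u + ∇_μH_jC̃H_j*u − ∇_μM(K₂u) − ∇_μK₂*(Mu) + ∇_μK₂*(M(K₂u))` — (2.129) at the vector
`u` (p22's `G_apply_V1`), `(I − K₂)* = I − K₂*`, `G̃_j = (I − H_jQ_j)G^{(n^{d+1})}` (p22's `Gt_eq_comp_GE`), linearity.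
[cite: Balaban1984PropagatorsII, (2.129)–(2.131) p.246] -/
theorem DGDadj_apply_eq (lam mu : Fin (d + 1)) (J : BondSpace (⟨d + 1, L, m, K, hd, hL⟩ : Params)) :
    ((((L : ℝ) ^ j) • (onE (LinearMap.funLeft ℝ ℝ (fun b : PBond (⟨d + 1, L, m, K, hd, hL⟩ : Params) 0 => (⟨b.src.shift mu, b.dir⟩ : PBond (⟨d + 1, L, m, K, hd, hL⟩ : Params) 0))) - LinearMap.id) : BondSpace (⟨d + 1, L, m, K, hd, hL⟩ : Params) →ₗ[ℝ] BondSpace (⟨d + 1, L, m, K, hd, hL⟩ : Params))) ((tsV1 hc Λ' w).G (((((L : ℝ) ^ j) • (onE (LinearMap.funLeft ℝ ℝ (fun b : PBond (⟨d + 1, L, m, K, hd, hL⟩ : Params) 0 => (⟨b.src.unshift lam, b.dir⟩ : PBond (⟨d + 1, L, m, K, hd, hL⟩ : Params) 0))) - LinearMap.id) : BondSpace (⟨d + 1, L, m, K, hd, hL⟩ : Params) →ₗ[ℝ] BondSpace (⟨d + 1, L, m, K, hd, hL⟩ : Params))) J)) =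
      (((((L : ℝ) ^ j) • (onE (LinearMap.funLeft ℝ ℝ (fun b : PBond (⟨d + 1, L, m, K, hd, hL⟩ : Params) 0 => (⟨b.src.shift mu, b.dir⟩ : PBond (⟨d + 1, L, m, K, hd, hL⟩ : Params) 0))) - LinearMap.id) : BondSpace (⟨d + 1, L, m, K, hd, hL⟩ : Params) →ₗ[ℝ] BondSpace (⟨d + 1, L, m, K, hd, hL⟩ : Params))) ∘ₗ ((tsV1 hc Λ' w).K1 ∘ₗ ((((L : ℝ) ^ j) • (onE (LinearMap.funLeft ℝ ℝ (fun b : PBond (⟨d + 1, L, m, K, hd, hL⟩ : Params) 0 => (⟨b.src.unshift lam, b.dir⟩ : PBond (⟨d + 1, L, m, K, hd, hL⟩ : Params) 0))) - LinearMap.id) : BondSpace (⟨d + 1, L, m, K, hd, hL⟩ : Params) →ₗ[ℝ] BondSpace (⟨d + 1, L, m, K, hd, hL⟩ : Params))))) J + (((((L : ℝ) ^ j) • (onE (LinearMap.funLeft ℝ ℝ (fun b : PBond (⟨d + 1, L, m, K, hd, hL⟩ : Params) 0 => (⟨b.src.shift mu, b.dir⟩ : PBond (⟨d + 1, L, m,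 K, hd, hL⟩ : Params) 0))) - LinearMap.id) : BondSpace (⟨d + 1, L, m, K, hd, hL⟩ : Params) →ₗ[ℝ] BondSpace (⟨d + 1, L, m, K, hd, hL⟩ : Params))) ∘ₗ (GE (Domains.whole (P := (⟨d + 1, L, m, K, hd, hL⟩ : Params)) j (Nat.le_of_succ_le hj)) hc (w := fun _ => 1 * ((L : ℝ) ^ j) ^ (d + 1)) (fun _ => hw') ∘ₗ ((((L : ℝ) ^ j) • (onE (LinearMap.funLeft ℝ ℝ (fun b : PBond (⟨d + 1, L, m, K, hd, hL⟩ : Params) 0 => (⟨b.src.unshift lam, b.dir⟩ : PBond (⟨d + 1, L, m, K, hd, hL⟩ : Params) 0))) - LinearMap.id) : BondSpace (⟨d + 1, L, m, K, hd, hL⟩ : Params) →ₗ[ℝ] BondSpace (⟨d + 1, L, m, K, hd, hL⟩ : Params))))) J - ((((((L : ℝ) ^ j) • (onE (LinearMap.funLeft ℝ ℝ (fun b : PBond (⟨d + 1, L, m, K, hd, hL⟩ : Params) 0 => (⟨b.src.shift mu, b.dir⟩ : PBond (⟨d + 1, L, m, K, hd, hL⟩ : Params) 0))) - LinearMap.id)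 : BondSpace (⟨d + 1, L, m, K, hd, hL⟩ : Params) →ₗ[ℝ] BondSpace (⟨d + 1, L, m, K, hd, hL⟩ : Params))) ∘ₗ (tsV1 hc Λ' w).Hj) ∘ₗ ((tsV1 hc Λ' w).Qv ∘ₗ (GE (Domains.whole (P := (⟨d + 1, L, m, K, hd, hL⟩ : Params)) j (Nat.le_of_succ_le hj)) hc (w := fun _ => 1 * ((L : ℝ) ^ j) ^ (d + 1)) (fun _ => hw') ∘ₗ ((((L : ℝ) ^ j) • (onE (LinearMap.funLeft ℝ ℝ (fun b : PBond (⟨d + 1, L, m, K, hd, hL⟩ : Params) 0 => (⟨b.src.unshift lam, b.dir⟩ : PBond (⟨d + 1, L, m, K, hd, hL⟩ : Params) 0))) - LinearMap.id) : BondSpace (⟨d + 1, L, m, K, hd, hL⟩ : Params) →ₗ[ℝ] BondSpace (⟨d + 1, L, m, K, hd, hL⟩ : Params)))))) J + (((((L : ℝ) ^ j) • (onE (LinearMap.funLeft ℝ ℝ (fun b : PBond (⟨d + 1, L, m, K, hd, hL⟩ : Params) 0 => (⟨b.src.shift mu, b.dir⟩ : PBond (⟨d + 1, L, m, K, hd,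 hL⟩ : Params) 0))) - LinearMap.id) : BondSpace (⟨d + 1, L, m, K, hd, hL⟩ : Params) →ₗ[ℝ] BondSpace (⟨d + 1, L, m, K, hd, hL⟩ : Params))) ∘ₗ (((tsV1 hc Λ' w).Hj ∘ₗ (tsV1 hc Λ' w).Ct ∘ₗ LinearMap.adjoint (tsV1 hc Λ' w).Hj) ∘ₗ ((((L : ℝ) ^ j) • (onE (LinearMap.funLeft ℝ ℝ (fun b : PBond (⟨d + 1, L, m, K, hd, hL⟩ : Params) 0 => (⟨b.src.unshift lam, b.dir⟩ : PBond (⟨d + 1, L, m, K, hd, hL⟩ : Params) 0))) - LinearMap.id) : BondSpace (⟨d + 1, L, m, K, hd, hL⟩ : Params) →ₗ[ℝ] BondSpace (⟨d + 1, L, m, K, hd, hL⟩ : Params))))) J - ((((((L : ℝ) ^ j) • (onE (LinearMap.funLeft ℝ ℝ (fun b : PBond (⟨d + 1, L, m, K, hd, hL⟩ : Params) 0 => (⟨b.src.shift mu, b.dir⟩ : PBond (⟨d + 1, L, m, K, hd, hL⟩ : Params) 0))) - LinearMap.id) : BondSpace (⟨d + 1, L, m, K, hd, hL⟩ : Params)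 →ₗ[ℝ] BondSpace (⟨d + 1, L, m, K, hd, hL⟩ : Params))) ∘ₗ (tsV1 hc Λ' w).Gt + ((((L : ℝ) ^ j) • (onE (LinearMap.funLeft ℝ ℝ (fun b : PBond (⟨d + 1, L, m, K, hd, hL⟩ : Params) 0 => (⟨b.src.shift mu, b.dir⟩ : PBond (⟨d + 1, L, m, K, hd, hL⟩ : Params) 0))) - LinearMap.id) : BondSpace (⟨d + 1, L, m, K, hd, hL⟩ : Params) →ₗ[ℝ] BondSpace (⟨d + 1, L, m, K, hd, hL⟩ : Params))) ∘ₗ ((tsV1 hc Λ' w).Hj ∘ₗ (tsV1 hc Λ' w).Ct ∘ₗ LinearMap.adjoint (tsV1 hc Λ' w).Hj)) ∘ₗ ((tsV1 hc Λ' w).K2 ∘ₗ ((((L : ℝ) ^ j) • (onE (LinearMap.funLeft ℝ ℝ (fun b : PBond (⟨d + 1, L, m, K, hd, hL⟩ : Params) 0 => (⟨b.src.unshift lam, b.dir⟩ : PBond (⟨d + 1, L, m, K, hd, hL⟩ : Params) 0))) - LinearMap.id) : BondSpace (⟨d + 1, L, m, K, hd, hL⟩ : Params) →ₗ[ℝ]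 BondSpace (⟨d + 1, L, m, K, hd, hL⟩ : Params))))) J - ((((((L : ℝ) ^ j) • (onE (LinearMap.funLeft ℝ ℝ (fun b : PBond (⟨d + 1, L, m, K, hd, hL⟩ : Params) 0 => (⟨b.src.shift mu, b.dir⟩ : PBond (⟨d + 1, L, m, K, hd, hL⟩ : Params) 0))) - LinearMap.id) : BondSpace (⟨d + 1, L, m, K, hd, hL⟩ : Params) →ₗ[ℝ] BondSpace (⟨d + 1, L, m, K, hd, hL⟩ : Params))) ∘ₗ LinearMap.adjoint (tsV1 hc Λ' w).K2) ∘ₗ ((tsV1 hc Λ' w).Gt ∘ₗ ((((L : ℝ) ^ j) • (onE (LinearMap.funLeft ℝ ℝ (fun b : PBond (⟨d + 1, L, m, K, hd, hL⟩ : Params) 0 => (⟨b.src.unshift lam, b.dir⟩ : PBond (⟨d + 1, L, m, K, hd, hL⟩ : Params) 0))) - LinearMap.id) : BondSpace (⟨d + 1, L, m, K, hd, hL⟩ : Params) →ₗ[ℝ] BondSpace (⟨d + 1, L, m, K, hd, hL⟩ : Params))) + ((tsV1 hc Λ' w).Hj ∘ₗ (tsV1 hc Λ' w).Ct ∘ₗ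 LinearMap.adjoint (tsV1 hc Λ' w).Hj) ∘ₗ ((((L : ℝ) ^ j) • (onE (LinearMap.funLeft ℝ ℝ (fun b : PBond (⟨d + 1, L, m, K, hd, hL⟩ : Params) 0 => (⟨b.src.unshift lam, b.dir⟩ : PBond (⟨d + 1, L, m, K, hd, hL⟩ : Params) 0))) - LinearMap.id) : BondSpace (⟨d + 1, L, m, K, hd, hL⟩ : Params) →ₗ[ℝ] BondSpace (⟨d + 1, L, m, K, hd, hL⟩ : Params))))) J + ((((((L : ℝ) ^ j) • (onE (LinearMap.funLeft ℝ ℝ (fun b : PBond (⟨d + 1, L, m, K, hd, hL⟩ : Params) 0 => (⟨b.src.shift mu, b.dir⟩ : PBond (⟨d + 1, L, m, K, hd, hL⟩ : Params) 0))) - LinearMap.id) : BondSpace (⟨d + 1, L, m, K, hd, hL⟩ : Params) →ₗ[ℝ] BondSpace (⟨d + 1, L, m, K, hd, hL⟩ : Params))) ∘ₗ LinearMap.adjoint (tsV1 hc Λ' w).K2) ∘ₗ (((tsV1 hc Λ' w).Gt + (tsV1 hc Λ' w).Hj ∘ₗ (tsV1 hc Λ' w).Ct ∘ₗ LinearMap.adjoint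 (tsV1 hc Λ' w).Hj) ∘ₗ ((tsV1 hc Λ' w).K2 ∘ₗ ((((L : ℝ) ^ j) • (onE (LinearMap.funLeft ℝ ℝ (fun b : PBond (⟨d + 1, L, m, K, hd, hL⟩ : Params) 0 => (⟨b.src.unshift lam, b.dir⟩ : PBond (⟨d + 1, L, m, K, hd, hL⟩ : Params) 0))) - LinearMap.id) : BondSpace (⟨d + 1, L, m, K, hd, hL⟩ : Params) →ₗ[ℝ] BondSpace (⟨d + 1, L, m, K, hd, hL⟩ : Params)))))) J := by
  set u : BondSpace (⟨d + 1, L, m, K, hd, hL⟩ : Params) := ((((L : ℝ) ^ j) • (onE (LinearMap.funLeft ℝ ℝ (fun b : PBond (⟨d + 1, L, m, K, hd, hL⟩ : Params) 0 => (⟨b.src.unshift lam, b.dir⟩ : PBond (⟨d + 1, L, m, K, hd, hL⟩ : Params) 0))) - LinearMap.id) : BondSpace (⟨d + 1, L, m, K, hd, hL⟩ : Params) →ₗ[ℝ] BondSpace (⟨d + 1, L, m, K, hd, hL⟩ : Params))) J with hu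
  have hadj : LinearMap.adjoint (LinearMap.id - (tsV1 hc Λ' w).K2) = LinearMap.id - LinearMap.adjoint (tsV1 hc Λ' w).K2 := by
    rw [map_sub, LinearMap.adjoint_id]
  have hGt : (tsV1 hc Λ' w).Gt u = GE (Domains.whole (P := (⟨d + 1, L, m, K, hd, hL⟩ : Params)) j (Nat.le_of_succ_le hj)) hc (w := fun _ => 1 * ((L : ℝ) ^ j) ^ (d + 1)) (fun _ => hw') u - (tsV1 hc Λ' w).Hj ((tsV1 hc Λ' w).Qv (GE (Domains.whole (P := (⟨d + 1, L, m, K, hd, hL⟩ : Params)) j (Nat.le_of_succ_le hj)) hc (w := fun _ => 1 * ((L : ℝ) ^ j) ^ (d + 1)) (fun _ => hw') u)) := by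
    have h := LinearMap.congr_fun (Gt_eq_comp_GE hc hj Λ' hw hw') u
    rw [h, LinearMap.comp_apply, LinearMap.sub_apply, LinearMap.id_apply, LinearMap.comp_apply]
  have hG := G_apply_V1 hc hj Λ' hw u
  rw [hadj] at hG
  -- unfold the compositions on the right-hand side (the source `u = ∇_λ*J` stays folded)
  simp only [LinearMap.comp_apply, LinearMap.add_apply]
  rw [← hu, hG]
  simp only [LinearMap.sub_apply, LinearMap.id_apply, LinearMap.add_apply, LinearMap.comp_apply, map_add, map_sub, hGt]
  abel

include hw hw' in
/-- the same identity at a fine bond `b₀`. [cite: Balaban1984PropagatorsII, (2.129)–(2.131) p.246] -/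
theorem DGDadj_apply_eq_at (lam mu : Fin (d + 1)) (J : BondSpace (⟨d + 1, L, m, K, hd, hL⟩ : Params)) (b₀ : PBond (⟨d + 1, L, m, K, hd, hL⟩ : Params) 0) :
    ((((L : ℝ) ^ j) • (onE (LinearMap.funLeft ℝ ℝ (fun b : PBond (⟨d + 1, L, m, K, hd, hL⟩ : Params) 0 => (⟨b.src.shift mu, b.dir⟩ : PBond (⟨d + 1, L, m, K, hd, hL⟩ : Params) 0))) - LinearMap.id) : BondSpace (⟨d + 1, L, m, K, hd, hL⟩ : Params) →ₗ[ℝ] BondSpace (⟨d + 1, L, m, K, hd, hL⟩ : Params))) ((tsV1 hc Λ' w).G (((((L : ℝ) ^ j) • (onE (LinearMap.funLeft ℝ ℝ (fun b : PBond (⟨d + 1, L, m, K, hd, hL⟩ : Params) 0 => (⟨b.src.unshift lam, b.dir⟩ : PBond (⟨d + 1, L, m, K, hd, hL⟩ : Params) 0))) - LinearMap.id) : BondSpace (⟨d + 1, L, m, K, hd, hL⟩ : Params) →ₗ[ℝ] BondSpace (⟨d + 1, L, m, K, hd, hL⟩ : Params))) J)) b₀ =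
      (((((L : ℝ) ^ j) • (onE (LinearMap.funLeft ℝ ℝ (fun b : PBond (⟨d + 1, L, m, K, hd, hL⟩ : Params) 0 => (⟨b.src.shift mu, b.dir⟩ : PBond (⟨d + 1, L, m, K, hd, hL⟩ : Params) 0))) - LinearMap.id) : BondSpace (⟨d + 1, L, m, K, hd, hL⟩ : Params) →ₗ[ℝ] BondSpace (⟨d + 1, L, m, K, hd, hL⟩ : Params))) ∘ₗ ((tsV1 hc Λ' w).K1 ∘ₗ ((((L : ℝ) ^ j) • (onE (LinearMap.funLeft ℝ ℝ (fun b : PBond (⟨d + 1, L, m, K, hd, hL⟩ : Params) 0 => (⟨b.src.unshift lam, b.dir⟩ : PBond (⟨d + 1, L, m, K, hd, hL⟩ : Params) 0))) - LinearMap.id) : BondSpace (⟨d + 1, L, m, K, hd, hL⟩ : Params) →ₗ[ℝ] BondSpace (⟨d + 1, L, m, K, hd, hL⟩ : Params))))) J b₀ + (((((L : ℝ) ^ j) • (onE (LinearMap.funLeft ℝ ℝ (fun b : PBond (⟨d + 1, L, m, K, hd, hL⟩ : Params) 0 => (⟨b.src.shift mu, b.dir⟩ : PBond (⟨d + 1,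 L, m, K, hd, hL⟩ : Params) 0))) - LinearMap.id) : BondSpace (⟨d + 1, L, m, K, hd, hL⟩ : Params) →ₗ[ℝ] BondSpace (⟨d + 1, L, m, K, hd, hL⟩ : Params))) ∘ₗ (GE (Domains.whole (P := (⟨d + 1, L, m, K, hd, hL⟩ : Params)) j (Nat.le_of_succ_le hj)) hc (w := fun _ => 1 * ((L : ℝ) ^ j) ^ (d + 1)) (fun _ => hw') ∘ₗ ((((L : ℝ) ^ j) • (onE (LinearMap.funLeft ℝ ℝ (fun b : PBond (⟨d + 1, L, m, K, hd, hL⟩ : Params) 0 => (⟨b.src.unshift lam, b.dir⟩ : PBond (⟨d + 1, L, m, K, hd, hL⟩ : Params) 0))) - LinearMap.id) : BondSpace (⟨d + 1, L, m, K, hd, hL⟩ : Params) →ₗ[ℝ] BondSpace (⟨d + 1, L, m, K, hd, hL⟩ : Params))))) J b₀ - ((((((L : ℝ) ^ j) • (onE (LinearMap.funLeft ℝ ℝ (fun b : PBond (⟨d + 1, L, m, K, hd, hL⟩ : Params) 0 => (⟨b.src.shift mu, b.dir⟩ : PBond (⟨d + 1, L, m, K, hd, hL⟩ : Params) 0)))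 - LinearMap.id) : BondSpace (⟨d + 1, L, m, K, hd, hL⟩ : Params) →ₗ[ℝ] BondSpace (⟨d + 1, L, m, K, hd, hL⟩ : Params))) ∘ₗ (tsV1 hc Λ' w).Hj) ∘ₗ ((tsV1 hc Λ' w).Qv ∘ₗ (GE (Domains.whole (P := (⟨d + 1, L, m, K, hd, hL⟩ : Params)) j (Nat.le_of_succ_le hj)) hc (w := fun _ => 1 * ((L : ℝ) ^ j) ^ (d + 1)) (fun _ => hw') ∘ₗ ((((L : ℝ) ^ j) • (onE (LinearMap.funLeft ℝ ℝ (fun b : PBond (⟨d + 1, L, m, K, hd, hL⟩ : Params) 0 => (⟨b.src.unshift lam, b.dir⟩ : PBond (⟨d + 1, L, m, K, hd, hL⟩ : Params) 0))) - LinearMap.id) : BondSpace (⟨d + 1, L, m, K, hd, hL⟩ : Params) →ₗ[ℝ] BondSpace (⟨d + 1, L, m, K, hd, hL⟩ : Params)))))) J b₀ + (((((L : ℝ) ^ j) • (onE (LinearMap.funLeft ℝ ℝ (fun b : PBond (⟨d + 1, L, m, K, hd, hL⟩ : Params) 0 => (⟨b.src.shift mu, b.dir⟩ : PBond (⟨d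 + 1, L, m, K, hd, hL⟩ : Params) 0))) - LinearMap.id) : BondSpace (⟨d + 1, L, m, K, hd, hL⟩ : Params) →ₗ[ℝ] BondSpace (⟨d + 1, L, m, K, hd, hL⟩ : Params))) ∘ₗ (((tsV1 hc Λ' w).Hj ∘ₗ (tsV1 hc Λ' w).Ct ∘ₗ LinearMap.adjoint (tsV1 hc Λ' w).Hj) ∘ₗ ((((L : ℝ) ^ j) • (onE (LinearMap.funLeft ℝ ℝ (fun b : PBond (⟨d + 1, L, m, K, hd, hL⟩ : Params) 0 => (⟨b.src.unshift lam, b.dir⟩ : PBond (⟨d + 1, L, m, K, hd, hL⟩ : Params) 0))) - LinearMap.id) : BondSpace (⟨d + 1, L, m, K, hd, hL⟩ : Params) →ₗ[ℝ] BondSpace (⟨d + 1, L, m, K, hd, hL⟩ : Params))))) J b₀ - ((((((L : ℝ) ^ j) • (onE (LinearMap.funLeft ℝ ℝ (fun b : PBond (⟨d + 1, L, m, K, hd, hL⟩ : Params) 0 => (⟨b.src.shift mu, b.dir⟩ : PBond (⟨d + 1, L, m, K, hd, hL⟩ : Params) 0))) - LinearMap.id) : BondSpace (⟨d + 1, L,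 m, K, hd, hL⟩ : Params) →ₗ[ℝ] BondSpace (⟨d + 1, L, m, K, hd, hL⟩ : Params))) ∘ₗ (tsV1 hc Λ' w).Gt + ((((L : ℝ) ^ j) • (onE (LinearMap.funLeft ℝ ℝ (fun b : PBond (⟨d + 1, L, m, K, hd, hL⟩ : Params) 0 => (⟨b.src.shift mu, b.dir⟩ : PBond (⟨d + 1, L, m, K, hd, hL⟩ : Params) 0))) - LinearMap.id) : BondSpace (⟨d + 1, L, m, K, hd, hL⟩ : Params) →ₗ[ℝ] BondSpace (⟨d + 1, L, m, K, hd, hL⟩ : Params))) ∘ₗ ((tsV1 hc Λ' w).Hj ∘ₗ (tsV1 hc Λ' w).Ct ∘ₗ LinearMap.adjoint (tsV1 hc Λ' w).Hj)) ∘ₗ ((tsV1 hc Λ' w).K2 ∘ₗ ((((L : ℝ) ^ j) • (onE (LinearMap.funLeft ℝ ℝ (fun b : PBond (⟨d + 1, L, m, K, hd, hL⟩ : Params) 0 => (⟨b.src.unshift lam, b.dir⟩ : PBond (⟨d + 1, L, m, K, hd, hL⟩ : Params) 0))) - LinearMap.id) : BondSpace (⟨d + 1, L, m, K, hd, hL⟩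 : Params) →ₗ[ℝ] BondSpace (⟨d + 1, L, m, K, hd, hL⟩ : Params))))) J b₀ - ((((((L : ℝ) ^ j) • (onE (LinearMap.funLeft ℝ ℝ (fun b : PBond (⟨d + 1, L, m, K, hd, hL⟩ : Params) 0 => (⟨b.src.shift mu, b.dir⟩ : PBond (⟨d + 1, L, m, K, hd, hL⟩ : Params) 0))) - LinearMap.id) : BondSpace (⟨d + 1, L, m, K, hd, hL⟩ : Params) →ₗ[ℝ] BondSpace (⟨d + 1, L, m, K, hd, hL⟩ : Params))) ∘ₗ LinearMap.adjoint (tsV1 hc Λ' w).K2) ∘ₗ ((tsV1 hc Λ' w).Gt ∘ₗ ((((L : ℝ) ^ j) • (onE (LinearMap.funLeft ℝ ℝ (fun b : PBond (⟨d + 1, L, m, K, hd, hL⟩ : Params) 0 => (⟨b.src.unshift lam, b.dir⟩ : PBond (⟨d + 1, L, m, K, hd, hL⟩ : Params) 0))) - LinearMap.id) : BondSpace (⟨d + 1, L, m, K, hd, hL⟩ : Params) →ₗ[ℝ] BondSpace (⟨d + 1, L, m, K, hd, hL⟩ : Params))) + ((tsV1 hc Λ' w).Hj ∘ₗ (tsV1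 hc Λ' w).Ct ∘ₗ LinearMap.adjoint (tsV1 hc Λ' w).Hj) ∘ₗ ((((L : ℝ) ^ j) • (onE (LinearMap.funLeft ℝ ℝ (fun b : PBond (⟨d + 1, L, m, K, hd, hL⟩ : Params) 0 => (⟨b.src.unshift lam, b.dir⟩ : PBond (⟨d + 1, L, m, K, hd, hL⟩ : Params) 0))) - LinearMap.id) : BondSpace (⟨d + 1, L, m, K, hd, hL⟩ : Params) →ₗ[ℝ] BondSpace (⟨d + 1, L, m, K, hd, hL⟩ : Params))))) J b₀ + ((((((L : ℝ) ^ j) • (onE (LinearMap.funLeft ℝ ℝ (fun b : PBond (⟨d + 1, L, m, K, hd, hL⟩ : Params) 0 => (⟨b.src.shift mu, b.dir⟩ : PBond (⟨d + 1, L, m, K, hd, hL⟩ : Params) 0))) - LinearMap.id) : BondSpace (⟨d + 1, L, m, K, hd, hL⟩ : Params) →ₗ[ℝ] BondSpace (⟨d + 1, L, m, K, hd, hL⟩ : Params))) ∘ₗ LinearMap.adjoint (tsV1 hc Λ' w).K2) ∘ₗ (((tsV1 hc Λ' w).Gt + (tsV1 hc Λ' w).Hj ∘ₗ (tsV1 hc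 Λ' w).Ct ∘ₗ LinearMap.adjoint (tsV1 hc Λ' w).Hj) ∘ₗ ((tsV1 hc Λ' w).K2 ∘ₗ ((((L : ℝ) ^ j) • (onE (LinearMap.funLeft ℝ ℝ (fun b : PBond (⟨d + 1, L, m, K, hd, hL⟩ : Params) 0 => (⟨b.src.unshift lam, b.dir⟩ : PBond (⟨d + 1, L, m, K, hd, hL⟩ : Params) 0))) - LinearMap.id) : BondSpace (⟨d + 1, L, m, K, hd, hL⟩ : Params) →ₗ[ℝ] BondSpace (⟨d + 1, L, m, K, hd, hL⟩ : Params)))))) J b₀ := by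
  have h := congrArg (fun v : BondSpace (⟨d + 1, L, m, K, hd, hL⟩ : Params) => v b₀) (DGDadj_apply_eq hc hj Λ' hw hw' lam mu J)
  simpa only [PiLp.add_apply, PiLp.sub_apply] using h

end Identity

/-! ## §2  Proposition 2.5, the member (1.112), in the printed shape -/

/-- decay bookkeeping: `e^{−δρ(y₀, y′)} ≤ e^{δr}e^{−δρ(y, y′)}` when `ρ(y₀, y) ≤ r` (`δ ≥ 0`). [cite: Balaban1984PropagatorsI, Prop. 1.2 (1.112) p.36 (constants bookkeeping, ours)] -/
private theorem exp_decay_shift {ρ₀ ρ ρ₁ r δ : ℝ} (hδ : 0 ≤ δ) (htri : ρ ≤ ρ₁ + ρ₀) (hρ₁ : ρ₁ ≤ r) :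
    Real.exp (-(δ * ρ₀)) ≤ Real.exp (δ * r) * Real.exp (-(δ * ρ)) := by
  rw [← Real.exp_add]
  exact Real.exp_le_exp.mpr (by nlinarith)

/-- `|t₁ + t₂ − t₃ + t₄ − t₅ − t₆ + t₇| ≤ B₁ + … + B₇` from `|tᵢ| ≤ Bᵢ`. [cite: Balaban1984PropagatorsII, Prop. 2.5 p.246 (bookkeeping of the seven summands, ours)] -/
private theorem abs_seven_le {t₁ t₂ t₃ t₄ t₅ t₆ t₇ B₁ B₂ B₃ B₄ B₅ B₆ B₇ : ℝ} (h₁ : |t₁| ≤ B₁) (h₂ : |t₂| ≤ B₂) (h₃ : |t₃| ≤ B₃)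
    (h₄ : |t₄| ≤ B₄) (h₅ : |t₅| ≤ B₅) (h₆ : |t₆| ≤ B₆) (h₇ : |t₇| ≤ B₇) :
    |t₁ + t₂ - t₃ + t₄ - t₅ - t₆ + t₇| ≤ B₁ + B₂ + B₃ + B₄ + B₅ + B₆ + B₇ := by
  have := abs_add_le (t₁ + t₂ - t₃ + t₄ - t₅ - t₆) t₇
  have := abs_sub (t₁ + t₂ - t₃ + t₄ - t₅) t₆
  have := abs_sub (t₁ + t₂ - t₃ + t₄) t₅
  have := abs_add_le (t₁ + t₂ - t₃) t₄
  have := abs_sub (t₁ + t₂) t₃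
  have := abs_add_le t₁ t₂
  linarith

/-- re-anchoring the (1.112) summand: `e^{(1+δ)(r+3)}e^{−δρ(y₀,y′)} ≤ e^{(1+2δ)(r+3)}e^{−δρ(y,y′)}` when `e^{−δρ₀} ≤ e^{δr}e^{−δρ}` (pure real
arithmetic, stated over opaque reals so that no operator term is re-elaborated). [cite: Balaban1984PropagatorsI, Prop. 1.2 (1.112) p.36 (constants bookkeeping, ours)] -/
private theorem reanchor_le {t C₂ δ r ρ₀ ρ W : ℝ} (hC₂ : 0 ≤ C₂) (hW : 0 ≤ W) (hδ : 0 ≤ δ)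
    (hsh : Real.exp (-(δ * ρ₀)) ≤ Real.exp (δ * r) * Real.exp (-(δ * ρ)))
    (ht : |t| ≤ C₂ * Real.exp ((1 + δ) * (r + 3)) * Real.exp (-(δ * ρ₀)) * W) :
    |t| ≤ C₂ * Real.exp ((1 + 2 * δ) * (r + 3)) * Real.exp (-(δ * ρ)) * W := by
  refine ht.trans ?_
  have h1 : Real.exp ((1 + δ) * (r + 3)) * Real.exp (δ * r) ≤ Real.exp ((1 + 2 * δ) * (r + 3)) := by
    rw [← Real.exp_add]
    exact Real.exp_le_exp.mpr (by nlinarith)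
  calc C₂ * Real.exp ((1 + δ) * (r + 3)) * Real.exp (-(δ * ρ₀)) * W
      ≤ C₂ * Real.exp ((1 + δ) * (r + 3)) * (Real.exp (δ * r) * Real.exp (-(δ * ρ))) * W := by gcongr
    _ = C₂ * (Real.exp ((1 + δ) * (r + 3)) * Real.exp (δ * r)) * Real.exp (-(δ * ρ)) * W := by ring
    _ ≤ C₂ * Real.exp ((1 + 2 * δ) * (r + 3)) * Real.exp (-(δ * ρ)) * W := by gcongr

/-- assembling the seven summands of `∇_μG∇_λ*J` into the printed bound `C·E₁·E₂·(X_ε + X)` with `C = (C₁ + C₃ + C₄ + C₅ + C₆ + C₇)·K + C₂`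
(pure real arithmetic over opaque reals). [cite: Balaban1984PropagatorsII, Prop. 2.5 p.246 (bookkeeping of the seven summands, ours)] -/
private theorem assemble_seven_le {t₁ t₂ t₃ t₄ t₅ t₆ t₇ C₁ C₂ C₃ C₄ C₅ C₆ C₇ K E₁ E₂ X Xε : ℝ}
    (hC₁ : 0 ≤ C₁) (hC₃ : 0 ≤ C₃) (hC₄ : 0 ≤ C₄) (hC₅ : 0 ≤ C₅) (hC₆ : 0 ≤ C₆) (hC₇ : 0 ≤ C₇) (hK : 0 ≤ K) (hE₁ : 0 ≤ E₁) (hE₂ : 0 ≤ E₂)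
    (hXε : 0 ≤ Xε)
    (h₁ : |t₁| ≤ C₁ * (K * E₁) * E₂ * X) (h₂ : |t₂| ≤ C₂ * E₁ * E₂ * (Xε + X)) (h₃ : |t₃| ≤ C₃ * (K * E₁) * E₂ * X)
    (h₄ : |t₄| ≤ C₄ * (K * E₁) * E₂ * X) (h₅ : |t₅| ≤ C₅ * (K * E₁) * E₂ * X) (h₆ : |t₆| ≤ C₆ * (K * E₁) * E₂ * X)
    (h₇ : |t₇| ≤ C₇ * (K * E₁) * E₂ * X) :
    |t₁ + t₂ - t₃ + t₄ - t₅ - t₆ + t₇| ≤ ((C₁ + C₃ + C₄ + C₅ + C₆ + C₇) * K + C₂) * E₁ * E₂ * (Xε + X) := by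
  have hX : ∀ {C : ℝ}, 0 ≤ C → C * (K * E₁) * E₂ * X ≤ C * (K * E₁) * E₂ * (Xε + X) := fun hC =>
    mul_le_mul_of_nonneg_left (le_add_of_nonneg_left hXε) (by positivity)
  refine (abs_seven_le (h₁.trans (hX hC₁)) h₂ (h₃.trans (hX hC₃)) (h₄.trans (hX hC₄)) (h₅.trans (hX hC₅)) (h₆.trans (hX hC₆))
    (h₇.trans (hX hC₇))).trans (le_of_eq ?_)
  ring

set_option maxRecDepth 8192 in
open Classical in
/-- **PROPOSITION 2.5, THE MEMBER (1.112) FOR THE GENUINE TWO-SCALE `G` OF (2.90), AT EVERY SMALLER RATE** (v1.1, for the (1.113) assembly of file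
M6): as `prop25_ineq112` below, with ONE `δ₀ > 0` (on `d, L, a₀, a₁`) and the bound `C_ε·e^{(1+2δ)(r+3)}·e^{−δ|y − y′|_T}·(X_ε + X)` for EVERY rate
`0 < δ ≤ δ₀` (the constant `C_ε` independent of `δ`) — the same proof, the block bounds weakened to the rate `δ` before the radius-`r` packaging.
[cite: Balaban1984PropagatorsII, Prop. 2.5 p.246; Balaban1984PropagatorsI, Prop. 1.2 (1.112) p.36, (1.109) p.35] -/
theorem prop25_ineq112_upto (d L : ℕ) (hd : 1 ≤ d + 1) (hL : Odd L ∧ 1 < L) {a₀ a₁ : ℝ} (ha₀ : 0 < a₀) (ha₁ : a₀ ≤ a₁) :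
    ∃ δ₀ : ℝ, 0 < δ₀ ∧ ∀ δ : ℝ, 0 < δ → δ ≤ δ₀ → ∀ ε : ℝ, 0 < ε → ε < 1 → ∃ C : ℝ, 0 ≤ C ∧ ∀ (m K : ℕ) (j : ℕ) (hc : ((L : ℝ) ^ j) ≠ 0)
      (_hj : j + 1 ≤ (⟨d + 1, L, m, K, hd, hL⟩ : Params).m + (⟨d + 1, L, m, K, hd, hL⟩ : Params).K)
      (Λ' : Finset (Site (⟨d + 1, L, m, K, hd, hL⟩ : Params) (j + 1))) (w : CIdx j Λ' → ℝ)
      (_hw0 : ∀ i, a₀ * ((L : ℝ) ^ j) ^ (d + 1) ≤ w i) (_hw1 : ∀ i, w i ≤ a₁ * ((L : ℝ) ^ j) ^ (d + 1)) (lam mu : Fin (d + 1))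
      (r : ℝ) (_hr : 0 ≤ r) (J : BondSpace (⟨d + 1, L, m, K, hd, hL⟩ : Params)) (X Xε : ℝ) (_hX : 0 ≤ X) (_hXε : 0 ≤ Xε) (y y' : Site (⟨d + 1, L, m, K, hd, hL⟩ : Params) j)
      (_hsupp : ∀ b : PBond (⟨d + 1, L, m, K, hd, hL⟩ : Params) 0, J b ≠ 0 → torusSupNorm (Mk (⟨d + 1, L, m, K, hd, hL⟩ : Params) j) (rep (Mk (⟨d + 1, L, m, K, hd, hL⟩ : Params) j) (iterBlockOf j b.src) - rep (Mk (⟨d + 1, L, m, K, hd, hL⟩ : Params) j) y') ≤ r)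
      (_hJ : ∀ b : PBond (⟨d + 1, L, m, K, hd, hL⟩ : Params) 0, |J b| ≤ X)
      (_hH : ∀ b b' : PBond (⟨d + 1, L, m, K, hd, hL⟩ : Params) 0, b.dir = b'.dir → supDist b.src b'.src ≤ L ^ j →
        |J b - J b'| ≤ Xε * (((supDist b.src b'.src : ℕ) : ℝ) / (L : ℝ) ^ j) ^ ε)
      (b₀ : PBond (⟨d + 1, L, m, K, hd, hL⟩ : Params) 0) (_hb₀ : torusSupNorm (Mk (⟨d + 1, L, m, K, hd, hL⟩ : Params) j) (rep (Mk (⟨d + 1, L, m, K, hd, hL⟩ : Params) j) (iterBlockOf j b₀.src) - rep (Mk (⟨d + 1, L, m, K, hd, hL⟩ : Params) j) y) ≤ r),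
      |((((L : ℝ) ^ j) • (onE (LinearMap.funLeft ℝ ℝ (fun b : PBond (⟨d + 1, L, m, K, hd, hL⟩ : Params) 0 => (⟨b.src.shift mu, b.dir⟩ : PBond (⟨d + 1, L, m, K, hd, hL⟩ : Params) 0))) - LinearMap.id) : BondSpace (⟨d + 1, L, m, K, hd, hL⟩ : Params) →ₗ[ℝ] BondSpace (⟨d + 1, L, m, K, hd, hL⟩ : Params))) ((tsV1 hc Λ' w).G (((((L : ℝ) ^ j) • (onE (LinearMap.funLeft ℝ ℝ (fun b : PBond (⟨d + 1, L, m, K, hd, hL⟩ : Params) 0 => (⟨b.src.unshift lam, b.dir⟩ : PBond (⟨d + 1, L, m, K, hd, hL⟩ : Params) 0))) - LinearMap.id) : BondSpace (⟨d + 1, L, m, K, hd, hL⟩ : Params) →ₗ[ℝ] BondSpace (⟨d + 1, L, m, K, hd, hL⟩ : Params))) J)) b₀| ≤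
        C * Real.exp ((1 + 2 * δ) * (r + 3)) * Real.exp (-(δ * torusSupNorm (Mk (⟨d + 1, L, m, K, hd, hL⟩ : Params) j) (rep (Mk (⟨d + 1, L, m, K, hd, hL⟩ : Params) j) y - rep (Mk (⟨d + 1, L, m, K, hd, hL⟩ : Params) j) y'))) * (Xε + X) := by
  obtain ⟨δ₁, hδ₁, C₁, hC₁, hT1⟩ := blockBound_DK1Dadj_scaling d L hd hL
  obtain ⟨δ₂, hδ₂, HT2⟩ := cubeSup112_DGEDadj_scaling d L hd hL one_pos
  obtain ⟨δ₃, hδ₃, C₃, hC₃, hT3⟩ := blockBound_DHjQGEDadj_scaling d L hd hL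
  obtain ⟨δ₄, hδ₄, C₄, hC₄, hT4⟩ := blockBound_DHjCtDHjadj_scaling d L hd hL ha₀ ha₁
  obtain ⟨δ₅, hδ₅, C₅, hC₅, hDGt⟩ := blockBound_DGt_scaling d L hd hL
  obtain ⟨δ₆, hδ₆, C₆, hC₆, hDHCH⟩ := blockBound_DHjCtHj_scaling d L hd hL ha₀ ha₁
  obtain ⟨δ₇, hδ₇, C₇, hC₇, hK2D⟩ := blockBound_K2Dadj_scaling d L hd hL
  obtain ⟨δ₈, hδ₈, C₈, hC₈, hDK2a⟩ := blockBound_DK2adj_scaling d L hd hL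
  obtain ⟨δ₉, hδ₉, C₉, hC₉, hGtD⟩ := blockBound_GtDadj_scaling d L hd hL
  obtain ⟨δ₁₀, hδ₁₀, C₁₀, hC₁₀, hHCHD⟩ := blockBound_HjCtDHjadj_scaling d L hd hL ha₀ ha₁
  obtain ⟨δ₁₁, hδ₁₁, C₁₁, hC₁₁, hGt⟩ := blockBound_Gt_scaling d L hd hL
  obtain ⟨δ₁₂, hδ₁₂, C₁₂, hC₁₂, hHCH⟩ := blockBound_HjCtHj_scaling d L hd hL ha₀ ha₁
  -- the common `ε`-free rate
  set δ₀ : ℝ := min (min (min (min δ₁ δ₂) (min δ₃ δ₄)) (min (min δ₅ δ₆) (min δ₇ δ₈))) (min (min δ₉ δ₁₀) (min δ₁₁ δ₁₂)) with hδ₀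
  have hδ₀0 : 0 < δ₀ :=
    lt_min (lt_min (lt_min (lt_min hδ₁ hδ₂) (lt_min hδ₃ hδ₄)) (lt_min (lt_min hδ₅ hδ₆) (lt_min hδ₇ hδ₈))) (lt_min (lt_min hδ₉ hδ₁₀) (lt_min hδ₁₁ hδ₁₂))
  have h01 : δ₀ ≤ δ₁ := (min_le_left _ _).trans ((min_le_left _ _).trans ((min_le_left _ _).trans (min_le_left _ _)))
  have h02 : δ₀ ≤ δ₂ := (min_le_left _ _).trans ((min_le_left _ _).trans ((min_le_left _ _).trans (min_le_right _ _)))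
  have h03 : δ₀ ≤ δ₃ := (min_le_left _ _).trans ((min_le_left _ _).trans ((min_le_right _ _).trans (min_le_left _ _)))
  have h04 : δ₀ ≤ δ₄ := (min_le_left _ _).trans ((min_le_left _ _).trans ((min_le_right _ _).trans (min_le_right _ _)))
  have h05 : δ₀ ≤ δ₅ := (min_le_left _ _).trans ((min_le_right _ _).trans ((min_le_left _ _).trans (min_le_left _ _)))
  have h06 : δ₀ ≤ δ₆ := (min_le_left _ _).trans ((min_le_right _ _).trans ((min_le_left _ _).trans (min_le_right _ _)))
  have h07 : δ₀ ≤ δ₇ := (min_le_left _ _).trans ((min_le_right _ _).trans ((min_le_right _ _).trans (min_le_left _ _)))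
  have h08 : δ₀ ≤ δ₈ := (min_le_left _ _).trans ((min_le_right _ _).trans ((min_le_right _ _).trans (min_le_right _ _)))
  have h09 : δ₀ ≤ δ₉ := (min_le_right _ _).trans ((min_le_left _ _).trans (min_le_left _ _))
  have h010 : δ₀ ≤ δ₁₀ := (min_le_right _ _).trans ((min_le_left _ _).trans (min_le_right _ _))
  have h011 : δ₀ ≤ δ₁₁ := (min_le_right _ _).trans ((min_le_right _ _).trans (min_le_left _ _))
  have h012 : δ₀ ≤ δ₁₂ := (min_le_right _ _).trans ((min_le_right _ _).trans (min_le_right _ _))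
  -- rate bookkeeping and nonnegativity of the constants, ONCE, in the small context (explicit terms; no `set`, no `positivity`)
  have hs0' : δ₀ / 4 ≤ δ₀ := by linarith
  have hh0 : (0 : ℝ) ≤ δ₀ / 2 := by linarith
  have hh : δ₀ / 2 ≤ δ₀ := by linarith
  have hh2 : δ₀ / 2 < δ₀ := by linarith
  have h40 : (0 : ℝ) ≤ δ₀ / 4 := by linarith
  have h42 : δ₀ / 4 ≤ δ₀ / 2 := by linarith
  have h4lt : δ₀ / 4 < δ₀ := by linarith
  have hδh : (0 : ℝ) ≤ δ₀ - δ₀ / 2 := by linarith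
  have hδq : (0 : ℝ) ≤ δ₀ - δ₀ / 4 := by linarith
  have hKa0 : 0 ≤ latticeConst (d + 1) (δ₀ - δ₀ / 2) := latticeConst_nonneg _ hδh
  have hKb0 : 0 ≤ latticeConst (d + 1) (δ₀ - δ₀ / 4) := latticeConst_nonneg _ hδq
  have hK10 : 0 ≤ latticeConst (d + 1) 1 := latticeConst_nonneg _ zero_le_one
  have hL0 : 0 < L := by have := hL.2; omega
  have hLp : (0 : ℝ) < L := by exact_mod_cast hL0
  have hq0 : 0 < δ₀ / 4 := div_pos hδ₀0 four_pos
  have hq2 : δ₀ / 4 ≤ δ₂ := h42.trans (hh.trans h02)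
  have hC50 : 0 ≤ (C₅ + C₆) * C₇ * latticeConst (d + 1) (δ₀ - δ₀ / 2) := mul_nonneg (mul_nonneg (add_nonneg hC₅ hC₆) hC₇) hKa0
  have hC60 : 0 ≤ C₈ * (C₉ + C₁₀) * latticeConst (d + 1) (δ₀ - δ₀ / 2) := mul_nonneg (mul_nonneg hC₈ (add_nonneg hC₉ hC₁₀)) hKa0
  have hC7g : 0 ≤ (C₁₁ + C₁₂) * C₇ * latticeConst (d + 1) (δ₀ - δ₀ / 2) := mul_nonneg (mul_nonneg (add_nonneg hC₁₁ hC₁₂) hC₇) hKa0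
  have hC70 : 0 ≤ C₈ * ((C₁₁ + C₁₂) * C₇ * latticeConst (d + 1) (δ₀ - δ₀ / 2)) * latticeConst (d + 1) (δ₀ - δ₀ / 4) := mul_nonneg (mul_nonneg hC₈ hC7g) hKb0
  refine ⟨δ₀ / 4, hq0, fun δ hδ hδ4 ε hε0 hε1 => ?_⟩
  obtain ⟨C₂, hC₂, hT2⟩ := HT2 δ hδ (hδ4.trans hq2) ε hε0 hε1
  have hq : δ ≤ δ₀ := hδ4.trans hs0'
  have hq2' : δ ≤ δ₀ / 2 := hδ4.trans h42
  refine ⟨(C₁ + C₃ + C₄ + (C₅ + C₆) * C₇ * latticeConst (d + 1) (δ₀ - δ₀ / 2) + C₈ * (C₉ + C₁₀) * latticeConst (d + 1) (δ₀ - δ₀ / 2) + C₈ * ((C₁₁ + C₁₂) * C₇ * latticeConst (d + 1) (δ₀ - δ₀ / 2)) * latticeConst (d + 1) (δ₀ - δ₀ / 4)) * latticeConst (d + 1) 1 + C₂,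
    add_nonneg (mul_nonneg (add_nonneg (add_nonneg (add_nonneg (add_nonneg (add_nonneg hC₁ hC₃) hC₄) hC50) hC60) hC70) hK10) hC₂, ?_⟩
  intro m K j hc hj Λ' w hw0 hw1 lam mu r hr J X Xε hX hXε y y' hsupp hJ hH b₀ hb₀
  have hLj : (0 : ℝ) < (L : ℝ) ^ j := pow_pos hLp j
  have hw : ∀ i, 0 < w i := fun i => lt_of_lt_of_le (mul_pos ha₀ (pow_pos hLj (d + 1))) (hw0 i)
  have hw' : (0 : ℝ) < 1 * ((L : ℝ) ^ j) ^ (d + 1) := by rw [one_mul]; exact pow_pos hLj (d + 1)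
  -- the level-`j` block map and the block metric (elaborated once; every operator below is taken from the TYPE of its block-bound theorem)
  have hρ : IsPseudoDist (fun t t' : Site (⟨d + 1, L, m, K, hd, hL⟩ : Params) j => torusSupNorm (Mk (⟨d + 1, L, m, K, hd, hL⟩ : Params) j) (rep (Mk (⟨d + 1, L, m, K, hd, hL⟩ : Params) j) t - rep (Mk (⟨d + 1, L, m, K, hd, hL⟩ : Params) j) t')) := torusDist_isPseudoDist (Mk (⟨d + 1, L, m, K, hd, hL⟩ : Params) j)
  have hK : SumBound (fun t t' : Site (⟨d + 1, L, m, K, hd, hL⟩ : Params) j => torusSupNorm (Mk (⟨d + 1, L, m, K, hd, hL⟩ : Params) j) (rep (Mk (⟨d + 1, L, m, K, hd, hL⟩ : Params) j) t - rep (Mk (⟨d + 1, L, m, K, hd, hL⟩ : Params) j) t')) (fun a => latticeConst (d + 1) a) := torusDist_sumBound (Mk (⟨d + 1, L, m, K, hd, hL⟩ : Params) j)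
  have hsupp' : ∀ b : PBond (⟨d + 1, L, m, K, hd, hL⟩ : Params) 0, J b ≠ 0 → torusSupNorm (Mk (⟨d + 1, L, m, K, hd, hL⟩ : Params) j) (rep (Mk (⟨d + 1, L, m, K, hd, hL⟩ : Params) j) (iterBlockOf j b.src) - rep (Mk (⟨d + 1, L, m, K, hd, hL⟩ : Params) j) y') ≤ r + 3 := fun b hb => (hsupp b hb).trans (le_add_of_nonneg_right zero_le_three)
  have hb₀' : torusSupNorm (Mk (⟨d + 1, L, m, K, hd, hL⟩ : Params) j) (rep (Mk (⟨d + 1, L, m, K, hd, hL⟩ : Params) j) (iterBlockOf j b₀.src) - rep (Mk (⟨d + 1, L, m, K, hd, hL⟩ : Params) j) y) ≤ r + 3 := hb₀.trans (le_add_of_nonneg_right zero_le_three)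
  -- (a) the block bounds of the six block summands, all at the rate `δ` (the operators are NOT restated: `_` is read off the factor theorems)
  have b1 := blockBound_mono hρ _ (fun b₀ : PBond (⟨d + 1, L, m, K, hd, hL⟩ : Params) 0 => iterBlockOf j b₀.src) (fun b₀ : PBond (⟨d + 1, L, m, K, hd, hL⟩ : Params) 0 => iterBlockOf j b₀.src) hC₁ le_rfl (hq.trans h01) (hT1 m K j hc hj Λ' w hw lam mu)
  have b3 := blockBound_mono hρ _ (fun b₀ : PBond (⟨d + 1, L, m, K, hd, hL⟩ : Params) 0 => iterBlockOf j b₀.src) (fun b₀ : PBond (⟨d + 1, L, m, K, hd, hL⟩ : Params) 0 => iterBlockOf j b₀.src) hC₃ le_rfl (hq.trans h03) (hT3 m K j hc hj Λ' w hw hw' lam mu)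
  have b4 := blockBound_mono hρ _ (fun b₀ : PBond (⟨d + 1, L, m, K, hd, hL⟩ : Params) 0 => iterBlockOf j b₀.src) (fun b₀ : PBond (⟨d + 1, L, m, K, hd, hL⟩ : Params) 0 => iterBlockOf j b₀.src) hC₄ le_rfl (hq.trans h04) (hT4 m K j hc hj Λ' w hw0 hw1 lam mu)
  have bDM := blockBound_add (ρ := (fun t t' : Site (⟨d + 1, L, m, K, hd, hL⟩ : Params) j => torusSupNorm (Mk (⟨d + 1, L, m, K, hd, hL⟩ : Params) j) (rep (Mk (⟨d + 1, L, m, K, hd, hL⟩ : Params) j) t - rep (Mk (⟨d + 1, L, m, K, hd, hL⟩ : Params) j) t'))) _ _ (fun b₀ : PBond (⟨d + 1, L, m, K, hd, hL⟩ : Params) 0 => iterBlockOf j b₀.src) (fun b₀ : PBond (⟨d + 1, L, m, K, hd, hL⟩ : Params) 0 => iterBlockOf j b₀.src)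
    (blockBound_mono hρ _ (fun b₀ : PBond (⟨d + 1, L, m, K, hd, hL⟩ : Params) 0 => iterBlockOf j b₀.src) (fun b₀ : PBond (⟨d + 1, L, m, K, hd, hL⟩ : Params) 0 => iterBlockOf j b₀.src) hC₅ le_rfl h05 (hDGt m K j hc hj Λ' w hw mu))
    (blockBound_mono hρ _ (fun b₀ : PBond (⟨d + 1, L, m, K, hd, hL⟩ : Params) 0 => iterBlockOf j b₀.src) (fun b₀ : PBond (⟨d + 1, L, m, K, hd, hL⟩ : Params) 0 => iterBlockOf j b₀.src) hC₆ le_rfl h06 (hDHCH m K j hc hj Λ' w hw0 hw1 mu))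
  have bK2D := blockBound_mono hρ _ (fun b₀ : PBond (⟨d + 1, L, m, K, hd, hL⟩ : Params) 0 => iterBlockOf j b₀.src) (fun b₀ : PBond (⟨d + 1, L, m, K, hd, hL⟩ : Params) 0 => iterBlockOf j b₀.src) hC₇ le_rfl h07 (hK2D m K j hc hj Λ' w hw lam)
  have b5' := blockBound_comp hρ hK _ _ (fun b₀ : PBond (⟨d + 1, L, m, K, hd, hL⟩ : Params) 0 => iterBlockOf j b₀.src) (fun b₀ : PBond (⟨d + 1, L, m, K, hd, hL⟩ : Params) 0 => iterBlockOf j b₀.src) (fun b₀ : PBond (⟨d + 1, L, m, K, hd, hL⟩ : Params) 0 => iterBlockOf j b₀.src)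
    (Cf := C₅ + C₆) (Cg := C₇) (add_nonneg hC₅ hC₆) hC₇ hh0 hh hh2 bDM bK2D
  have b5 := blockBound_mono hρ _ (fun b₀ : PBond (⟨d + 1, L, m, K, hd, hL⟩ : Params) 0 => iterBlockOf j b₀.src) (fun b₀ : PBond (⟨d + 1, L, m, K, hd, hL⟩ : Params) 0 => iterBlockOf j b₀.src) hC50 le_rfl hq2' b5'
  have bDK2a := blockBound_mono hρ _ (fun b₀ : PBond (⟨d + 1, L, m, K, hd, hL⟩ : Params) 0 => iterBlockOf j b₀.src) (fun b₀ : PBond (⟨d + 1, L, m, K, hd, hL⟩ : Params) 0 => iterBlockOf j b₀.src) hC₈ le_rfl h08 (hDK2a m K j hc hj Λ' w hw mu)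
  have bMD := blockBound_add (ρ := (fun t t' : Site (⟨d + 1, L, m, K, hd, hL⟩ : Params) j => torusSupNorm (Mk (⟨d + 1, L, m, K, hd, hL⟩ : Params) j) (rep (Mk (⟨d + 1, L, m, K, hd, hL⟩ : Params) j) t - rep (Mk (⟨d + 1, L, m, K, hd, hL⟩ : Params) j) t'))) _ _ (fun b₀ : PBond (⟨d + 1, L, m, K, hd, hL⟩ : Params) 0 => iterBlockOf j b₀.src) (fun b₀ : PBond (⟨d + 1, L, m, K, hd, hL⟩ : Params) 0 => iterBlockOf j b₀.src)
    (blockBound_mono hρ _ (fun b₀ : PBond (⟨d + 1, L, m, K, hd, hL⟩ : Params) 0 => iterBlockOf j b₀.src) (fun b₀ : PBond (⟨d + 1, L, m, K, hd, hL⟩ : Params) 0 => iterBlockOf j b₀.src) hC₉ le_rfl h09 (hGtD m K j hc hj Λ' w hw lam))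
    (blockBound_mono hρ _ (fun b₀ : PBond (⟨d + 1, L, m, K, hd, hL⟩ : Params) 0 => iterBlockOf j b₀.src) (fun b₀ : PBond (⟨d + 1, L, m, K, hd, hL⟩ : Params) 0 => iterBlockOf j b₀.src) hC₁₀ le_rfl h010 (hHCHD m K j hc hj Λ' w hw0 hw1 lam))
  have b6' := blockBound_comp hρ hK _ _ (fun b₀ : PBond (⟨d + 1, L, m, K, hd, hL⟩ : Params) 0 => iterBlockOf j b₀.src) (fun b₀ : PBond (⟨d + 1, L, m, K, hd, hL⟩ : Params) 0 => iterBlockOf j b₀.src) (fun b₀ : PBond (⟨d + 1, L, m, K, hd, hL⟩ : Params) 0 => iterBlockOf j b₀.src)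
    (Cf := C₈) (Cg := C₉ + C₁₀) hC₈ (add_nonneg hC₉ hC₁₀) hh0 hh hh2 bDK2a bMD
  have b6 := blockBound_mono hρ _ (fun b₀ : PBond (⟨d + 1, L, m, K, hd, hL⟩ : Params) 0 => iterBlockOf j b₀.src) (fun b₀ : PBond (⟨d + 1, L, m, K, hd, hL⟩ : Params) 0 => iterBlockOf j b₀.src) hC60 le_rfl hq2' b6'
  have bM := blockBound_add (ρ := (fun t t' : Site (⟨d + 1, L, m, K, hd, hL⟩ : Params) j => torusSupNorm (Mk (⟨d + 1, L, m, K, hd, hL⟩ : Params) j) (rep (Mk (⟨d + 1, L, m, K, hd, hL⟩ : Params) j) t - rep (Mk (⟨d + 1, L, m, K, hd, hL⟩ : Params) j) t'))) _ _ (fun b₀ : PBond (⟨d + 1, L, m, K, hd, hL⟩ : Params) 0 => iterBlockOf j b₀.src) (fun b₀ : PBond (⟨d + 1, L, m, K, hd, hL⟩ : Params) 0 => iterBlockOf j b₀.src)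
    (blockBound_mono hρ _ (fun b₀ : PBond (⟨d + 1, L, m, K, hd, hL⟩ : Params) 0 => iterBlockOf j b₀.src) (fun b₀ : PBond (⟨d + 1, L, m, K, hd, hL⟩ : Params) 0 => iterBlockOf j b₀.src) hC₁₁ le_rfl h011 (hGt m K j hc hj Λ' w hw))
    (blockBound_mono hρ _ (fun b₀ : PBond (⟨d + 1, L, m, K, hd, hL⟩ : Params) 0 => iterBlockOf j b₀.src) (fun b₀ : PBond (⟨d + 1, L, m, K, hd, hL⟩ : Params) 0 => iterBlockOf j b₀.src) hC₁₂ le_rfl h012 (hHCH m K j hc hj Λ' w hw0 hw1))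
  have bMK2D := blockBound_comp hρ hK _ _ (fun b₀ : PBond (⟨d + 1, L, m, K, hd, hL⟩ : Params) 0 => iterBlockOf j b₀.src) (fun b₀ : PBond (⟨d + 1, L, m, K, hd, hL⟩ : Params) 0 => iterBlockOf j b₀.src) (fun b₀ : PBond (⟨d + 1, L, m, K, hd, hL⟩ : Params) 0 => iterBlockOf j b₀.src)
    (Cf := C₁₁ + C₁₂) (Cg := C₇) (add_nonneg hC₁₁ hC₁₂) hC₇ hh0 hh hh2 bM bK2D
  have b7' := blockBound_comp hρ hK _ _ (fun b₀ : PBond (⟨d + 1, L, m, K, hd, hL⟩ : Params) 0 => iterBlockOf j b₀.src) (fun b₀ : PBond (⟨d + 1, L, m, K, hd, hL⟩ : Params) 0 => iterBlockOf j b₀.src) (fun b₀ : PBond (⟨d + 1, L, m, K, hd, hL⟩ : Params) 0 => iterBlockOf j b₀.src)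
    (Cf := C₈) (Cg := (C₁₁ + C₁₂) * C₇ * latticeConst (d + 1) (δ₀ - δ₀ / 2)) hC₈ hC7g
    h40 h42 h4lt bDK2a bMK2D
  have b7 := blockBound_mono hρ _ (fun b₀ : PBond (⟨d + 1, L, m, K, hd, hL⟩ : Params) 0 => iterBlockOf j b₀.src) (fun b₀ : PBond (⟨d + 1, L, m, K, hd, hL⟩ : Params) 0 => iterBlockOf j b₀.src) hC70 le_rfl hδ4 b7'
  -- (b) the six block summands evaluated at `J` (radius `r + 3`)
  have e1 := abs_apply_le_of_support hρ hK _ (fun b₀ : PBond (⟨d + 1, L, m, K, hd, hL⟩ : Params) 0 => iterBlockOf j b₀.src) (fun b₀ : PBond (⟨d + 1, L, m, K, hd, hL⟩ : Params) 0 => iterBlockOf j b₀.src) hC₁ hδ.le hX b1 J y y' hsupp' hJ b₀ hb₀'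
  have e3 := abs_apply_le_of_support hρ hK _ (fun b₀ : PBond (⟨d + 1, L, m, K, hd, hL⟩ : Params) 0 => iterBlockOf j b₀.src) (fun b₀ : PBond (⟨d + 1, L, m, K, hd, hL⟩ : Params) 0 => iterBlockOf j b₀.src) hC₃ hδ.le hX b3 J y y' hsupp' hJ b₀ hb₀'
  have e4 := abs_apply_le_of_support hρ hK _ (fun b₀ : PBond (⟨d + 1, L, m, K, hd, hL⟩ : Params) 0 => iterBlockOf j b₀.src) (fun b₀ : PBond (⟨d + 1, L, m, K, hd, hL⟩ : Params) 0 => iterBlockOf j b₀.src) hC₄ hδ.le hX b4 J y y' hsupp' hJ b₀ hb₀'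
  have e5 := abs_apply_le_of_support hρ hK _ (fun b₀ : PBond (⟨d + 1, L, m, K, hd, hL⟩ : Params) 0 => iterBlockOf j b₀.src) (fun b₀ : PBond (⟨d + 1, L, m, K, hd, hL⟩ : Params) 0 => iterBlockOf j b₀.src) hC50 hδ.le hX b5 J y y' hsupp' hJ b₀ hb₀'
  have e6 := abs_apply_le_of_support hρ hK _ (fun b₀ : PBond (⟨d + 1, L, m, K, hd, hL⟩ : Params) 0 => iterBlockOf j b₀.src) (fun b₀ : PBond (⟨d + 1, L, m, K, hd, hL⟩ : Params) 0 => iterBlockOf j b₀.src) hC60 hδ.le hX b6 J y y' hsupp' hJ b₀ hb₀'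
  have e7 := abs_apply_le_of_support hρ hK _ (fun b₀ : PBond (⟨d + 1, L, m, K, hd, hL⟩ : Params) 0 => iterBlockOf j b₀.src) (fun b₀ : PBond (⟨d + 1, L, m, K, hd, hL⟩ : Params) 0 => iterBlockOf j b₀.src) hC70 hδ.le hX b7 J y y' hsupp' hJ b₀ hb₀'
  -- (c) the (1.112) summand `∇_μG^{(n^{d+1})}∇_λ*J` (file M1b), its decay re-anchored from `y(b₀₋)` to `y` (real arithmetic only: `reanchor_le`)
  have e2 := reanchor_le hC₂ (add_nonneg hXε hX) hδ.le
    (exp_decay_shift (δ := δ) (r := r) hδ.le (hρ.triangle y (iterBlockOf j b₀.src) y') ((le_of_eq (hρ.symm y (iterBlockOf j b₀.src))).trans hb₀))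
    (hT2 m K j (Nat.le_of_succ_le hj) hc hw' lam mu J X Xε r hX hXε y' hsupp hJ hH b₀)
  -- (d) the identity and the triangle inequality (real arithmetic only: `assemble_seven_le`)
  rw [DGDadj_apply_eq_at (d := d) (L := L) (m := m) (K := K) (hd := hd) (hL := hL) hc hj Λ' hw hw' lam mu J b₀]
  exact assemble_seven_le hC₁ hC₃ hC₄ hC50 hC60 hC70 hK10 (Real.exp_pos _).le (Real.exp_pos _).le hXε e1 e2 e3 e4 e5 e6 e7

open Classical in
/-- **PROPOSITION 2.5, THE MEMBER (1.112) `|(∇G∇*J)(x)| ≤ O(1)e^{−δ₂|y−y′|}(‖J‖_ε + |J|)` FOR THE GENUINE TWO-SCALE `G` OF (2.90)**, `Λ′` arbitrary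
(at `c = L^j`, weights `a₀n^{d+1} ≤ w ≤ a₁n^{d+1}`), one component `μ` of `∇` and one component `λ` of `∇*`: there is `δ₂ > 0` depending on
`d, L, a₀, a₁` only and for every `0 < ε < 1` a `C_ε ≥ 0` such that for every volume, `j + 1 ≤ m + K`, `Λ′`, weights in the window, directions
`λ, μ`, radius `r ≥ 0`, every fine bond field `J` supported on the fine bonds over the unit sites within `r` of `y′` with `|J| ≤ X` and Hölder
quotients `|J(b) − J(b′)| ≤ X_ε·(|b₋ − b₋′|_∞/n)^ε` on same-direction pairs at `|b₋ − b₋′|_∞ ≤ n`, and every fine bond `b₀` over the unit sites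
within `r` of `y`: `|(∇_μG∇_λ*J)(b₀)| ≤ C_ε·e^{(1+2δ₂)(r+3)}·e^{−δ₂|y − y′|_T}·(X_ε + X)`, `(∇_λ*J)(b) = n(J(b − e_λ) − J(b))`,
`(∇_μA)(b) = n(A(b + e_μ) − A(b))`. [cite: Balaban1984PropagatorsII, Prop. 2.5 p.246; Balaban1984PropagatorsI, Prop. 1.2 (1.112) p.36, (1.109) p.35] -/
theorem prop25_ineq112 (d L : ℕ) (hd : 1 ≤ d + 1) (hL : Odd L ∧ 1 < L) {a₀ a₁ : ℝ} (ha₀ : 0 < a₀) (ha₁ : a₀ ≤ a₁) :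
    ∃ δ : ℝ, 0 < δ ∧ ∀ ε : ℝ, 0 < ε → ε < 1 → ∃ C : ℝ, 0 ≤ C ∧ ∀ (m K : ℕ) (j : ℕ) (hc : ((L : ℝ) ^ j) ≠ 0)
      (_hj : j + 1 ≤ (⟨d + 1, L, m, K, hd, hL⟩ : Params).m + (⟨d + 1, L, m, K, hd, hL⟩ : Params).K)
      (Λ' : Finset (Site (⟨d + 1, L, m, K, hd, hL⟩ : Params) (j + 1))) (w : CIdx j Λ' → ℝ)
      (_hw0 : ∀ i, a₀ * ((L : ℝ) ^ j) ^ (d + 1) ≤ w i) (_hw1 : ∀ i, w i ≤ a₁ * ((L : ℝ) ^ j) ^ (d + 1)) (lam mu : Fin (d + 1))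
      (r : ℝ) (_hr : 0 ≤ r) (J : BondSpace (⟨d + 1, L, m, K, hd, hL⟩ : Params)) (X Xε : ℝ) (_hX : 0 ≤ X) (_hXε : 0 ≤ Xε) (y y' : Site (⟨d + 1, L, m, K, hd, hL⟩ : Params) j)
      (_hsupp : ∀ b : PBond (⟨d + 1, L, m, K, hd, hL⟩ : Params) 0, J b ≠ 0 → torusSupNorm (Mk (⟨d + 1, L, m, K, hd, hL⟩ : Params) j) (rep (Mk (⟨d + 1, L, m, K, hd, hL⟩ : Params) j) (iterBlockOf j b.src) - rep (Mk (⟨d + 1, L, m, K, hd, hL⟩ : Params) j) y') ≤ r)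
      (_hJ : ∀ b : PBond (⟨d + 1, L, m, K, hd, hL⟩ : Params) 0, |J b| ≤ X)
      (_hH : ∀ b b' : PBond (⟨d + 1, L, m, K, hd, hL⟩ : Params) 0, b.dir = b'.dir → supDist b.src b'.src ≤ L ^ j →
        |J b - J b'| ≤ Xε * (((supDist b.src b'.src : ℕ) : ℝ) / (L : ℝ) ^ j) ^ ε)
      (b₀ : PBond (⟨d + 1, L, m, K, hd, hL⟩ : Params) 0) (_hb₀ : torusSupNorm (Mk (⟨d + 1, L, m, K, hd, hL⟩ : Params) j) (rep (Mk (⟨d + 1, L, m, K, hd, hL⟩ : Params) j) (iterBlockOf j b₀.src) - rep (Mk (⟨d + 1, L, m, K, hd, hL⟩ : Params) j) y) ≤ r),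
      |((((L : ℝ) ^ j) • (onE (LinearMap.funLeft ℝ ℝ (fun b : PBond (⟨d + 1, L, m, K, hd, hL⟩ : Params) 0 => (⟨b.src.shift mu, b.dir⟩ : PBond (⟨d + 1, L, m, K, hd, hL⟩ : Params) 0))) - LinearMap.id) : BondSpace (⟨d + 1, L, m, K, hd, hL⟩ : Params) →ₗ[ℝ] BondSpace (⟨d + 1, L, m, K, hd, hL⟩ : Params))) ((tsV1 hc Λ' w).G (((((L : ℝ) ^ j) • (onE (LinearMap.funLeft ℝ ℝ (fun b : PBond (⟨d + 1, L, m, K, hd, hL⟩ : Params) 0 => (⟨b.src.unshift lam, b.dir⟩ : PBond (⟨d + 1, L, m, K, hd, hL⟩ : Params) 0))) - LinearMap.id) : BondSpace (⟨d + 1, L, m, K, hd, hL⟩ : Params) →ₗ[ℝ] BondSpace (⟨d + 1, L, m, K, hd, hL⟩ : Params))) J)) b₀| ≤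
        C * Real.exp ((1 + 2 * δ) * (r + 3)) * Real.exp (-(δ * torusSupNorm (Mk (⟨d + 1, L, m, K, hd, hL⟩ : Params) j) (rep (Mk (⟨d + 1, L, m, K, hd, hL⟩ : Params) j) y - rep (Mk (⟨d + 1, L, m, K, hd, hL⟩ : Params) j) y'))) * (Xε + X) := by
  obtain ⟨δ₀, hδ₀, H⟩ := prop25_ineq112_upto d L hd hL ha₀ ha₁
  exact ⟨δ₀, hδ₀, fun ε hε0 hε1 => H δ₀ hδ₀ le_rfl ε hε0 hε1⟩

end Literature.MathematicalPhysics.QuantumFieldTheory.Balaban1983to89.B6Prop25Eq112TwoScaleV1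

end
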